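import Mathlib

/-!
# `stub_fiveFoldSubcubic` from a LINEAR five-fold count (reduction, card A of `GapTwelveToBarlow`)

Crux `SquareWellLayerCake.GapTwelveToBarlow` (stmt-AtomisticToContinuum-15807), line `Sketch`.
The curvature-ration mechanism (cards `cone-deficit-fivefold-sparsity`, `cbb-curvature-ration`)
is expected to deliver a LINEAR bound: `≤ C·D` sites with a five-fold bond within `D` of the
centre of an all-Good `2D`-ball (`D ≥ D₀`).  This file records the elementary passage from
that linear form to the `ε·D³` form in which `stub_fiveFoldSubcubic` is registered (choose
`D = max (max D₁ D₀) (max 1 (C/ε))`: `C·D ≤ εD·D ≤ ε D³`), so that the skeleton may register the linear statement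
as the stub and DERIVE the sub-cubic one.  The predicate `G` (all-Goodness of the `2D`-ball)
and the counted property `F` (carrying a five-fold bond) are arbitrary here; the corollary
`fiveFoldSubcubic_of_linear` is the verbatim instance.

Mathlib only; no named fact is used.
-/

namespace Summit.AtomisticToContinuum.Crystallization.Theorems.SquareWellLayerCakeGapTwelveToBarlow

/-- **Linear ⇒ sub-cubic (abstract form).**  If a count `c N x i D` is `≤ C·D` whenever
`D ≥ D₀` and a hypothesis `G N x i D` holds, then for every `ε > 0` and `D₁` there is
`D ≥ D₁` with `c N x i D ≤ ε·D³` whenever `G N x i D`. [folklore] -/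
theorem subcubic_of_linear
    {c : (N : ℕ) → (Fin N → EuclideanSpace ℝ (Fin 3)) → Fin N → ℝ → ℕ}
    {G : (N : ℕ) → (Fin N → EuclideanSpace ℝ (Fin 3)) → Fin N → ℝ → Prop}
    (hlin : ∃ C D₀ : ℝ, ∀ (N : ℕ) (x : Fin N → EuclideanSpace ℝ (Fin 3)) (i : Fin N) (D : ℝ),
      D₀ ≤ D → G N x i D → (c N x i D : ℝ) ≤ C * D) :
    ∀ ε : ℝ, 0 < ε → ∀ D₁ : ℝ, ∃ D : ℝ, D₁ ≤ D ∧
      ∀ (N : ℕ) (x : Fin N → EuclideanSpace ℝ (Fin 3)) (i : Fin N),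
        G N x i D → (c N x i D : ℝ) ≤ ε * D ^ 3 := by
  obtain ⟨C, D₀, h⟩ := hlin
  intro ε hε D₁
  refine ⟨max (max D₁ D₀) (max 1 (C / ε)), le_trans (le_max_left _ _) (le_max_left _ _), ?_⟩
  intro N x i hG
  set D := max (max D₁ D₀) (max 1 (C / ε)) with hDdef
  have hD0 : D₀ ≤ D := le_trans (le_max_right _ _) (le_max_left _ _)
  have hD1 : 1 ≤ D := le_trans (le_max_left _ _) (le_max_right _ _)
  have hDC : C / ε ≤ D := le_trans (le_max_right _ _) (le_max_right _ _)
  have hcount := h N x i D hD0 hG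
  have hεD : C ≤ ε * D := by rwa [div_le_iff₀' hε] at hDC
  have hDnn : 0 ≤ D := le_trans zero_le_one hD1
  calc (c N x i D : ℝ) ≤ C * D := hcount
    _ ≤ ε * D * D := mul_le_mul_of_nonneg_right hεD hDnn
    _ = ε * D ^ 2 := by ring
    _ ≤ ε * D ^ 3 :=
        mul_le_mul_of_nonneg_left (pow_le_pow_right₀ hD1 (by norm_num)) hε.le

/-- **`stub_fiveFoldSubcubic` from a linear five-fold count** (verbatim instance): if every
site whose `2D`-ball is all-Good (`D ≥ D₀`) has at most `C·D` sites within `D` carrying a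
five-fold bond, then the conclusion of `stub_fiveFoldSubcubic` holds. [folklore] -/
theorem fiveFoldSubcubic_of_linear
    (hlin : ∃ C D₀ : ℝ, ∀ (N : ℕ) (x : Fin N → EuclideanSpace ℝ (Fin 3)) (i : Fin N) (D : ℝ),
      D₀ ≤ D →
      (∀ j : Fin N, dist (x i) (x j) ≤ 2 * D →
        ((∀ j' : Fin N, dist (x j) (x j') ≤ 11 / 10 → ∀ k : Fin N, k ≠ j' →
            (55 : ℝ) / 57 ≤ dist (x j') (x k)) ∧
          (Finset.univ.filter fun j' : Fin N => j' ≠ j ∧ dist (x j) (x j') ≤ 1).card = 12 ∧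
          (Finset.univ.filter fun j' : Fin N => j' ≠ j ∧ dist (x j) (x j') ≤ 11 / 10).card ≤ 12)) →
      ((Finset.univ.filter fun j : Fin N => dist (x i) (x j) ≤ D ∧
          ∃ k : Fin N, j ≠ k ∧ dist (x j) (x k) ≤ 1 ∧
            (Finset.univ.filter fun l : Fin N =>
              l ≠ j ∧ l ≠ k ∧ dist (x j) (x l) ≤ 1 ∧ dist (x k) (x l) ≤ 1).card = 5).card : ℝ) ≤
        C * D) :
    ∀ ε : ℝ, 0 < ε → ∀ D₁ : ℝ, ∃ D : ℝ, D₁ ≤ D ∧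
      ∀ (N : ℕ) (x : Fin N → EuclideanSpace ℝ (Fin 3)) (i : Fin N),
      (∀ j : Fin N, dist (x i) (x j) ≤ 2 * D →
        ((∀ j' : Fin N, dist (x j) (x j') ≤ 11 / 10 → ∀ k : Fin N, k ≠ j' →
            (55 : ℝ) / 57 ≤ dist (x j') (x k)) ∧
          (Finset.univ.filter fun j' : Fin N => j' ≠ j ∧ dist (x j) (x j') ≤ 1).card = 12 ∧
          (Finset.univ.filter fun j' : Fin N => j' ≠ j ∧ dist (x j) (x j') ≤ 11 / 10).card ≤ 12)) →
      ((Finset.univ.filter fun j : Fin N => dist (x i) (x j) ≤ D ∧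
          ∃ k : Fin N, j ≠ k ∧ dist (x j) (x k) ≤ 1 ∧
            (Finset.univ.filter fun l : Fin N =>
              l ≠ j ∧ l ≠ k ∧ dist (x j) (x l) ≤ 1 ∧ dist (x k) (x l) ≤ 1).card = 5).card : ℝ) ≤
        ε * D ^ 3 := by
  classical
  exact subcubic_of_linear
    (c := fun N x i D => (Finset.univ.filter fun j : Fin N => dist (x i) (x j) ≤ D ∧
          ∃ k : Fin N, j ≠ k ∧ dist (x j) (x k) ≤ 1 ∧
            (Finset.univ.filter fun l : Fin N =>
              l ≠ j ∧ l ≠ k ∧ dist (x j) (x l) ≤ 1 ∧ dist (x k) (x l) ≤ 1).card = 5).card)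
    (G := fun N x i D => ∀ j : Fin N, dist (x i) (x j) ≤ 2 * D →
        ((∀ j' : Fin N, dist (x j) (x j') ≤ 11 / 10 → ∀ k : Fin N, k ≠ j' →
            (55 : ℝ) / 57 ≤ dist (x j') (x k)) ∧
          (Finset.univ.filter fun j' : Fin N => j' ≠ j ∧ dist (x j) (x j') ≤ 1).card = 12 ∧
          (Finset.univ.filter fun j' : Fin N => j' ≠ j ∧ dist (x j) (x j') ≤ 11 / 10).card ≤ 12))
    hlin


/-- Registered sub-goal form (closed statement) of `fiveFoldSubcubic_of_linear`: a LINEAR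
five-fold count on all-Good balls implies the registered sub-cubic stub `stub_fiveFoldSubcubic`
of line `Sketch`. [folklore] -/
theorem stub_fiveFoldSubcubicOfLinear :
    (∃ C D₀ : ℝ, ∀ (N : ℕ) (x : Fin N → EuclideanSpace ℝ (Fin 3)) (i : Fin N) (D : ℝ),
      D₀ ≤ D → (∀ j : Fin N, dist (x i) (x j) ≤ 2 * D →
        ((∀ j' : Fin N, dist (x j) (x j') ≤ 11 / 10 → ∀ k : Fin N, k ≠ j' →
            (55 : ℝ) / 57 ≤ dist (x j') (x k)) ∧
          (Finset.univ.filter fun j' : Fin N => j' ≠ j ∧ dist (x j) (x j') ≤ 1).card = 12 ∧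
          (Finset.univ.filter fun j' : Fin N => j' ≠ j ∧ dist (x j) (x j') ≤ 11 / 10).card ≤ 12)) → ((Finset.univ.filter fun j : Fin N => dist (x i) (x j) ≤ D ∧
          ∃ k : Fin N, j ≠ k ∧ dist (x j) (x k) ≤ 1 ∧
            (Finset.univ.filter fun l : Fin N =>
              l ≠ j ∧ l ≠ k ∧ dist (x j) (x l) ≤ 1 ∧ dist (x k) (x l) ≤ 1).card = 5).card : ℝ) ≤ C * D) →
    ∀ ε : ℝ, 0 < ε → ∀ D₁ : ℝ, ∃ D : ℝ, D₁ ≤ D ∧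
      ∀ (N : ℕ) (x : Fin N → EuclideanSpace ℝ (Fin 3)) (i : Fin N),
      (∀ j : Fin N, dist (x i) (x j) ≤ 2 * D →
        ((∀ j' : Fin N, dist (x j) (x j') ≤ 11 / 10 → ∀ k : Fin N, k ≠ j' →
            (55 : ℝ) / 57 ≤ dist (x j') (x k)) ∧
          (Finset.univ.filter fun j' : Fin N => j' ≠ j ∧ dist (x j) (x j') ≤ 1).card = 12 ∧
          (Finset.univ.filter fun j' : Fin N => j' ≠ j ∧ dist (x j) (x j') ≤ 11 / 10).card ≤ 12)) → ((Finset.univ.filter fun j : Fin N => dist (x i) (x j) ≤ D ∧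
          ∃ k : Fin N, j ≠ k ∧ dist (x j) (x k) ≤ 1 ∧
            (Finset.univ.filter fun l : Fin N =>
              l ≠ j ∧ l ≠ k ∧ dist (x j) (x l) ≤ 1 ∧ dist (x k) (x l) ≤ 1).card = 5).card : ℝ) ≤ ε * D ^ 3 :=
  fun hlin => fiveFoldSubcubic_of_linear hlin

end Summit.AtomisticToContinuum.Crystallization.Theorems.SquareWellLayerCakeGapTwelveToBarlow
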